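import Literature.AlgebraicGeometry.Motives.HodgeNumberFibreSemicontinuity
import Literature.AlgebraicGeometry.HodgeTheory.HarmonicFiltrationOperator
import HarnessLib

/-!
# The Hodge numbers of the fibres of a proper holomorphic submersion into a Kähler manifold are
# locally constant (Voisin I §9.3.2, Prop. 9.20: `Σ h^{p,q} = b_k` and upper semicontinuity)

Topic: Hodge numbers in families (Voisin (2002), §9.3.2). Theorems only, no definition, no named
fact. Written by the prover seat `hodge-nonav-prover-Bx` (g17, cell `hodge-nonav`) as brick **K3** of
the programme «GRIFFITHS-HOLOMORPHY» (memo `PROGRAMME-GRIFFITHS-HOLOMORPHY-Bx-g17.md`): the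
constant-rank hypothesis `hr` of `Literature.Analysis.Complex.exists_analyticOnNhd_frame_of_ker_of_differentiableAt`
for the Hodge bundles `F^p𝓗^k = ⨆_{r ≥ p} K^{r,k-r}`.

Setting of the tree's `le_finrank_hodgePQ_of_fibres` (`HodgeNumberFibreSemicontinuity`): `T` a complex
manifold with a Kähler metric `G_T`, `proj : T → B` a `C^∞` map to a real manifold, a submersion and
proper over an open `O ∋ s₀`, and a FAMILY of compact complex manifolds `X b` (all charted on `E₀`,
`dim_ℝ E₀ = n`) with injective holomorphic immersions `ψ b : X b → T` onto the fibres `proj⁻¹(b)`,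
`b ∈ O`. Voisin (2002), Prop. 9.20: "the function `b ↦ h^{p,q}(X_b)` is upper semicontinuous … if
`Σ_{p+q=k} h^{p,q}(X_b) = b_k` for `b` near `0` [Kähler fibres] then the `h^{p,q}(X_b)` are constant".

* `eventually_finrank_hodgePQ_le_of_fibres` — **upper semicontinuity, filter form**: for `k ≤ n` and
  every `(p,q)`, `dim K^{p,q}(X_b) ≤ dim K^{p,q}(X_{s₀})` for all `b` near `s₀` (the sequential
  `le_finrank_hodgePQ_of_fibres` and first countability of `B` at `s₀` through a chart);
* `sum_finrank_hodgePQ_eq_finrank` — `Σ_{p+q=k} dim K^{p,q}(M) = dim H^k_dR(M; ℂ)` on a compact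
  Kähler manifold (Hodge decomposition, `finrank_biSup_hodgePQ_eq_sum` + `iSup_hodgePQ_eq_top_holds`);
* `eventually_finrank_hodgePQ_eq_of_fibres` — **local constancy**: if moreover `dim H^k_dR(X_b; ℂ)`
  is constant near `s₀` (Ehresmann: the fibres are diffeomorphic — supplied by the consumer), then
  `dim K^{p,q}(X_b) = dim K^{p,q}(X_{s₀})` for all `b` near `s₀` and all `p + q = k`, and hence
  (`eventually_finrank_hodgeFiltration_eq_of_fibres`) `dim F^pH^k(X_b) = dim F^pH^k(X_{s₀})`.

## References

* C. Voisin, *Hodge Theory and Complex Algebraic Geometry I*, CUP 2002, §9.3.2 Prop. 9.20,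
  Thm. 9.23; §6.1.3. [cite: VoisinHodgeI2002, §9.3.2 Prop. 9.20]
* K. Kodaira, *Complex Manifolds and Deformation of Complex Structures*, Springer 1986, §7.2.
-/

noncomputable section

open scoped Manifold ContDiff Topology
open Bundle Module Set Filter Function Finset
open Literature.Geometry.Kaehler Literature.Geometry.Manifold Literature.NumberTheory.Transcendental

namespace Literature.AlgebraicGeometry.Motives

-- `TangentSpace I x = E` silently, as in the tree's form files.
set_option backward.isDefEq.respectTransparency false

universe u v

/-! ### The Hodge decomposition counts dimensions -/

section Sum

variable {E : Type*} [NormedAddCommGroup E] [NormedSpace ℂ E] [FiniteDimensional ℂ E]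
  {M : Type*} [TopologicalSpace M] [ChartedSpace E M] [IsManifold 𝓘(ℝ, E) ∞ M]
  [IsManifold 𝓘(ℂ, E) ω M] [T2Space M] [CompactSpace M]

/-- **`Σ_{p+q=k} dim K^{p,q}(M) = dim H^k_dR(M; ℂ)`** on a compact Kähler manifold (the Hodge
decomposition `H^k = ⨁ K^{p,q}`, Voisin (2002), §6.1.3 Prop. 6.11 / Cor. 6.14).
[cite: VoisinHodgeI2002, §6.1.3 Prop. 6.11] -/
theorem sum_finrank_hodgePQ_eq_finrank [IsKaehlerManifold E M] (k : ℕ) :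
    ∑ pq ∈ antidiagonal k, finrank ℂ ↥(hodgePQ E M k pq.1 pq.2) =
      finrank ℂ (complexDeRhamCohomology E M k) := by
  classical
  have h := Literature.AlgebraicGeometry.HodgeTheory.finrank_biSup_hodgePQ_eq_sum (E := E) (M := M) k
    (fun _ ↦ True)
  simp only [Finset.filter_true_of_mem (fun _ _ ↦ trivial)] at h
  have htop : (⨆ pq ∈ {pq ∈ antidiagonal k | True}, hodgePQ E M k pq.1 pq.2) = ⊤ := by
    rw [← iSup_hodgePQ_eq_top_holds (E := E) (M := M) k]
    simp only [Finset.filter_true_of_mem (fun _ _ ↦ trivial)]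
  rw [← h, htop, finrank_top]

end Sum

/-! ### The family -/

variable {ET : Type*} [NormedAddCommGroup ET] [NormedSpace ℂ ET] [FiniteDimensional ℂ ET]
  {T : Type*} [TopologicalSpace T] [ChartedSpace ET T] [IsManifold 𝓘(ℝ, ET) ∞ T]
  [IsManifold 𝓘(ℂ, ET) ω T] [T2Space T] [SecondCountableTopology T]
  (GT : ContMDiffRiemannianMetric 𝓘(ℝ, ET) ∞ ET (fun y : T ↦ TangentSpace 𝓘(ℝ, ET) y))
  {EB : Type*} [NormedAddCommGroup EB] [NormedSpace ℝ EB] [FiniteDimensional ℝ EB]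
  {B : Type*} [TopologicalSpace B] [ChartedSpace EB B] [IsManifold 𝓘(ℝ, EB) ∞ B]
  {E₀ : Type u} [NormedAddCommGroup E₀] [NormedSpace ℂ E₀] [FiniteDimensional ℂ E₀]
  {n : ℕ} [Fact (finrank ℝ E₀ = n)]
  {X : B → Type v} [∀ b, TopologicalSpace (X b)] [∀ b, ChartedSpace E₀ (X b)]
  [∀ b, IsManifold 𝓘(ℝ, E₀) ∞ (X b)] [∀ b, IsManifold 𝓘(ℂ, E₀) ω (X b)]
  [∀ b, T2Space (X b)] [∀ b, CompactSpace (X b)]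

/-- **Upper semicontinuity of `dim K^{p,q}` along a family of fibre models, filter form** (Voisin
(2002), §9.3.2 Prop. 9.20). In the setting of `le_finrank_hodgePQ_of_fibres`, with a family of
compact complex fibre models `ψ b : X b → T` (injective holomorphic immersions onto `proj⁻¹(b)` for
`b ∈ O`): for `k ≤ n` and all `p q`, `dim K^{p,q}(X b) ≤ dim K^{p,q}(X s₀)` for `b` near `s₀`.
[cite: VoisinHodgeI2002, §9.3.2 Prop. 9.20] -/
theorem eventually_finrank_hodgePQ_le_of_fibres (hGT : GT.toRiemannianMetric.IsKaehler)
    {proj : T → B} (hπ : ContMDiff 𝓘(ℝ, ET) 𝓘(ℝ, EB) ∞ proj) {s₀ : B} {O : Set B} (hO : IsOpen O)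
    (hs₀ : s₀ ∈ O) (hsub : ∀ x, proj x ∈ O → Surjective (mfderiv 𝓘(ℝ, ET) 𝓘(ℝ, EB) proj x))
    (hprop : ∀ K ⊆ O, IsCompact K → IsCompact (proj ⁻¹' K))
    (ψ : ∀ b, X b → T) (hψ : ∀ b ∈ O, ContMDiff 𝓘(ℝ, E₀) 𝓘(ℝ, ET) ∞ (ψ b))
    (hψi : ∀ b ∈ O, Injective (ψ b))
    (hψd : ∀ b ∈ O, ∀ y, Injective (mfderiv 𝓘(ℝ, E₀) 𝓘(ℝ, ET) (ψ b) y))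
    (hψJ : ∀ b ∈ O, ∀ (y : X b) (v : TangentSpace 𝓘(ℝ, E₀) y),
      mfderiv 𝓘(ℝ, E₀) 𝓘(ℝ, ET) (ψ b) y (tangentJ E₀ y v) =
        tangentJ ET (ψ b y) (mfderiv 𝓘(ℝ, E₀) 𝓘(ℝ, ET) (ψ b) y v))
    (hψr : ∀ b ∈ O, range (ψ b) = proj ⁻¹' {b})
    {k : ℕ} (hk : k ≤ n) (p q : ℕ) :
    ∀ᶠ b in 𝓝 s₀, finrank ℂ ↥(hodgePQ E₀ (X b) k p q) ≤ finrank ℂ ↥(hodgePQ E₀ (X s₀) k p q) := by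
  haveI : (𝓝 s₀).IsCountablyGenerated := by
    rw [← (chartAt EB s₀).symm_map_nhds_eq (mem_chart_source EB s₀)]
    infer_instance
  by_contra hnot
  rw [not_eventually] at hnot
  -- a sequence `s i → s₀` inside `O` with `dim K^{p,q}(X (s i)) > dim K^{p,q}(X s₀)`
  have hfreq : ∃ᶠ b in 𝓝 s₀,
      ¬(finrank ℂ ↥(hodgePQ E₀ (X b) k p q) ≤ finrank ℂ ↥(hodgePQ E₀ (X s₀) k p q)) ∧ b ∈ O :=
    hnot.and_eventually (hO.mem_nhds hs₀)
  obtain ⟨s, hs, hsP⟩ := exists_seq_forall_of_frequently hfreq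
  set N := finrank ℂ ↥(hodgePQ E₀ (X s₀) k p q) + 1 with hN
  have hle : N ≤ finrank ℂ ↥(hodgePQ E₀ (X s₀) k p q) :=
    le_finrank_hodgePQ_of_fibres GT hGT hπ hO hs₀ hsub hprop hs (hψ s₀ hs₀) (hψi s₀ hs₀) (hψd s₀ hs₀)
      (hψJ s₀ hs₀) (hψr s₀ hs₀) (fun _ ↦ E₀) (fun i ↦ X (s i)) (fun i ↦ ψ (s i))
      (fun i ↦ hψ _ (hsP i).2) (fun i ↦ hψi _ (hsP i).2) (fun i ↦ hψd _ (hsP i).2)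
      (fun i ↦ hψJ _ (hsP i).2) (fun i ↦ hψr _ (hsP i).2) hk (fun i ↦ by
        have := (hsP i).1
        omega)
  omega

/-- **Local constancy of the Hodge numbers of the fibres** (Voisin (2002), §9.3.2 Prop. 9.20, Kähler
case). Same setting; if in addition `dim H^k_dR(X b; ℂ) = dim H^k_dR(X s₀; ℂ)` for `b` near `s₀`
(Ehresmann: nearby fibres are diffeomorphic; supplied by the consumer) then for `b` near `s₀`,
`dim K^{p,q}(X b) = dim K^{p,q}(X s₀)` for ALL `p + q = k`: the `dim K^{p,q}` are upper semicontinuous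
and sum to the constant `dim H^k` (each `X b`, `b ∈ O`, is Kähler for the induced metric
`(ψ b)^* G_T`, `exists_isKaehler_inner_eq_pullback`). [cite: VoisinHodgeI2002, §9.3.2 Prop. 9.20] -/
theorem eventually_finrank_hodgePQ_eq_of_fibres (hGT : GT.toRiemannianMetric.IsKaehler)
    {proj : T → B} (hπ : ContMDiff 𝓘(ℝ, ET) 𝓘(ℝ, EB) ∞ proj) {s₀ : B} {O : Set B} (hO : IsOpen O)
    (hs₀ : s₀ ∈ O) (hsub : ∀ x, proj x ∈ O → Surjective (mfderiv 𝓘(ℝ, ET) 𝓘(ℝ, EB) proj x))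
    (hprop : ∀ K ⊆ O, IsCompact K → IsCompact (proj ⁻¹' K))
    (ψ : ∀ b, X b → T) (hψ : ∀ b ∈ O, ContMDiff 𝓘(ℝ, E₀) 𝓘(ℝ, ET) ∞ (ψ b))
    (hψi : ∀ b ∈ O, Injective (ψ b))
    (hψd : ∀ b ∈ O, ∀ y, Injective (mfderiv 𝓘(ℝ, E₀) 𝓘(ℝ, ET) (ψ b) y))
    (hψJ : ∀ b ∈ O, ∀ (y : X b) (v : TangentSpace 𝓘(ℝ, E₀) y),
      mfderiv 𝓘(ℝ, E₀) 𝓘(ℝ, ET) (ψ b) y (tangentJ E₀ y v) =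
        tangentJ ET (ψ b y) (mfderiv 𝓘(ℝ, E₀) 𝓘(ℝ, ET) (ψ b) y v))
    (hψr : ∀ b ∈ O, range (ψ b) = proj ⁻¹' {b})
    {k : ℕ} (hk : k ≤ n)
    (hb : ∀ᶠ b in 𝓝 s₀, finrank ℂ (complexDeRhamCohomology E₀ (X b) k) =
      finrank ℂ (complexDeRhamCohomology E₀ (X s₀) k)) :
    ∀ᶠ b in 𝓝 s₀, ∀ pq ∈ antidiagonal k,
      finrank ℂ ↥(hodgePQ E₀ (X b) k pq.1 pq.2) = finrank ℂ ↥(hodgePQ E₀ (X s₀) k pq.1 pq.2) := by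
  classical
  -- every fibre over `O` is Kähler for the induced metric
  have hK : ∀ b ∈ O, IsKaehlerManifold E₀ (X b) := fun b hbO ↦ by
    obtain ⟨g, hg, -⟩ := exists_isKaehler_inner_eq_pullback GT hGT (hψ b hbO) (hψJ b hbO) (hψd b hbO)
    exact ⟨⟨g, hg⟩⟩
  haveI : IsKaehlerManifold E₀ (X s₀) := hK s₀ hs₀
  -- upper semicontinuity for every `(p,q)` on the antidiagonal
  have hle : ∀ᶠ b in 𝓝 s₀, ∀ pq ∈ antidiagonal k,
      finrank ℂ ↥(hodgePQ E₀ (X b) k pq.1 pq.2) ≤ finrank ℂ ↥(hodgePQ E₀ (X s₀) k pq.1 pq.2) :=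
    (eventually_all_finset (antidiagonal k)).2 fun pq _ ↦
      eventually_finrank_hodgePQ_le_of_fibres GT hGT hπ hO hs₀ hsub hprop ψ hψ hψi hψd hψJ hψr hk pq.1 pq.2
  filter_upwards [hle, hb, hO.mem_nhds hs₀] with b hbl hbb hbO
  haveI : IsKaehlerManifold E₀ (X b) := hK b hbO
  have hsum : ∑ pq ∈ antidiagonal k, finrank ℂ ↥(hodgePQ E₀ (X b) k pq.1 pq.2) =
      ∑ pq ∈ antidiagonal k, finrank ℂ ↥(hodgePQ E₀ (X s₀) k pq.1 pq.2) := by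
    rw [sum_finrank_hodgePQ_eq_finrank, sum_finrank_hodgePQ_eq_finrank, hbb]
  exact (Finset.sum_eq_sum_iff_of_le hbl).1 hsum

/-- **Local constancy of `dim F^pH^k` of the fibres** (`F^p = ⨆_{r ≥ p} K^{r,k-r}`; Voisin (2002),
§9.3.2 Prop. 9.20 with §7.1.1): in the same setting, for `b` near `s₀` and EVERY `p`,
`dim (⨆_{r+s=k, p ≤ r} K^{r,s}(X b)) = dim (⨆_{r+s=k, p ≤ r} K^{r,s}(X s₀))` — the constant-rank
hypothesis of `exists_analyticOnNhd_frame_of_ker_of_differentiableAt` for the Hodge bundles.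
[cite: VoisinHodgeI2002, §9.3.2 Prop. 9.20] -/
theorem eventually_finrank_hodgeFiltration_eq_of_fibres (hGT : GT.toRiemannianMetric.IsKaehler)
    {proj : T → B} (hπ : ContMDiff 𝓘(ℝ, ET) 𝓘(ℝ, EB) ∞ proj) {s₀ : B} {O : Set B} (hO : IsOpen O)
    (hs₀ : s₀ ∈ O) (hsub : ∀ x, proj x ∈ O → Surjective (mfderiv 𝓘(ℝ, ET) 𝓘(ℝ, EB) proj x))
    (hprop : ∀ K ⊆ O, IsCompact K → IsCompact (proj ⁻¹' K))
    (ψ : ∀ b, X b → T) (hψ : ∀ b ∈ O, ContMDiff 𝓘(ℝ, E₀) 𝓘(ℝ, ET) ∞ (ψ b))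
    (hψi : ∀ b ∈ O, Injective (ψ b))
    (hψd : ∀ b ∈ O, ∀ y, Injective (mfderiv 𝓘(ℝ, E₀) 𝓘(ℝ, ET) (ψ b) y))
    (hψJ : ∀ b ∈ O, ∀ (y : X b) (v : TangentSpace 𝓘(ℝ, E₀) y),
      mfderiv 𝓘(ℝ, E₀) 𝓘(ℝ, ET) (ψ b) y (tangentJ E₀ y v) =
        tangentJ ET (ψ b y) (mfderiv 𝓘(ℝ, E₀) 𝓘(ℝ, ET) (ψ b) y v))
    (hψr : ∀ b ∈ O, range (ψ b) = proj ⁻¹' {b})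
    {k : ℕ} (hk : k ≤ n)
    (hb : ∀ᶠ b in 𝓝 s₀, finrank ℂ (complexDeRhamCohomology E₀ (X b) k) =
      finrank ℂ (complexDeRhamCohomology E₀ (X s₀) k)) :
    ∀ᶠ b in 𝓝 s₀, ∀ p : ℕ,
      finrank ℂ ↥(⨆ pq ∈ {pq ∈ antidiagonal k | p ≤ pq.1}, hodgePQ E₀ (X b) k pq.1 pq.2) =
        finrank ℂ ↥(⨆ pq ∈ {pq ∈ antidiagonal k | p ≤ pq.1}, hodgePQ E₀ (X s₀) k pq.1 pq.2) := by
  classical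
  have hK : ∀ b ∈ O, IsKaehlerManifold E₀ (X b) := fun b hbO ↦ by
    obtain ⟨g, hg, -⟩ := exists_isKaehler_inner_eq_pullback GT hGT (hψ b hbO) (hψJ b hbO) (hψd b hbO)
    exact ⟨⟨g, hg⟩⟩
  haveI : IsKaehlerManifold E₀ (X s₀) := hK s₀ hs₀
  filter_upwards [eventually_finrank_hodgePQ_eq_of_fibres GT hGT hπ hO hs₀ hsub hprop ψ hψ hψi hψd hψJ
    hψr hk hb, hO.mem_nhds hs₀] with b hbeq hbO p
  haveI : IsKaehlerManifold E₀ (X b) := hK b hbO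
  rw [Literature.AlgebraicGeometry.HodgeTheory.finrank_biSup_hodgePQ_eq_sum (E := E₀) (M := X b) k
      (fun pq ↦ p ≤ pq.1),
    Literature.AlgebraicGeometry.HodgeTheory.finrank_biSup_hodgePQ_eq_sum (E := E₀) (M := X s₀) k
      (fun pq ↦ p ≤ pq.1)]
  exact Finset.sum_congr rfl fun pq hpq ↦ hbeq pq (Finset.mem_filter.1 hpq).1

end Literature.AlgebraicGeometry.Motives

end
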